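import Summits.KontsevichZagierPeriods.Zeta5Search.Certificates.RayC1KernelPeriodicBridge
import Summits.KontsevichZagierPeriods.Zeta5Search.RVPeriodicR0
import Summits.KontsevichZagierPeriods.Zeta5Search.RayC1PeriodicCells000
import HarnessLib

/-!
# ζ(5) search — certificates: the PWin bridge for the cell touching `y = 0` (cell 0, `[0, 1/85)`): rows + fam-rv's boundary bound (TYPER g18)

HONEST FRAMING: systematic search; no irrationality claim unless certified.  Integer bookkeeping of explicit valuations; nothing
here is a statement about `ζ(5)`; every exponent this feeds is `< 1` (calibration ladder of the T1-map ray C1; no crossing claimed).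

OUR work (Summit side; typer seat, generation 18).  cert-1 g6's bridge `pwin_holds_of_rows` needs `0 < u₁` (the left end of the
cell), so the first Farey cell `y = n/p − m ∈ [0, 1/85)` of fam-denom's route-(A) table (`RayC1PeriodicCells000`, letter I, `B₁ = −6`)
had no `PWin` record.  Its closure contains the boundary `y = 0`, i.e. `p ∣ n`, `n = m·p`, which the row theorems exclude (strict
left inequality) but fam-rv g17's `RVPeriodicR0.r0_bound_dvd` covers with the SAME constant (`−6 − 256·m`).  Hence:
* `pwin_holds_of_rows_zero` — the four parity-class rows of a cell `[0, v₁/v₂)` with constants `≥ B`, together with `B ≤ −6`, give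
  `PWin.Holds ⟨0, 1, v1, v2, 0, B⟩` (interior primes from the rows, the boundary prime `p = n/m` from `r0_bound_dvd`);
* `pwin_C0 : PWin.Holds ⟨0, 1, 1, 85, 0, -6⟩`, and the one-record list `pwListZ` / `pwListZ_holds` in the shape of the
  `RayC1KernelPeriodicPW<k>` modules, so the periodic consumption rounds (`RayC1KernelClassR9`, …) consume cell 0 like any other cell
  (kind-4 windows `(85/(85m+1), 1/m − ε]` at shifts 1–3, periodic pieces `[ε, 1/85)` at `m ≥ 4`; ≈ 0.05 nats of the ray's θ ≤ 1 mass).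
-/

namespace Summit.KontsevichZagierPeriods.Zeta5Search.RayC1

open Summit.KontsevichZagierPeriods.Zeta5Search.CasoratianValuation (casoratian)
open Summit.KontsevichZagierPeriods.Zeta5Search.RVPeriodic (PWin r0_bound_dvd)
open Summit.KontsevichZagierPeriods.Zeta5Search.RayC1Periodic
open Summit.KontsevichZagierPeriods.Zeta5Search.T1Rays (bRay β1)

/-- **The bridge for a cell touching `y = 0`**: the four parity-class row bounds of the Farey cell `[0, v₁/v₂)` with class constants
`BO1, BE1, BO2, BE2 ≥ B`, `B ≤ −6` and `v₁ ≤ v₂` give `PWin.Holds ⟨0, 1, v1, v2, 0, B⟩` — at an interior prime (`p ∤ n`, so `m·p < n`) by the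
rows, at the boundary prime `p = n/m` by fam-rv's `r0_bound_dvd` (`−6 − 256·m`). -/
theorem pwin_holds_of_rows_zero {v1 v2 : ℕ} {B BO1 BE1 BO2 BE2 : ℤ}
    (hO1 : DBound₁ 0 1 v1 v2 1 BO1) (hE1 : DBound₁ 0 1 v1 v2 0 BE1)
    (hO2 : DBound₂ 0 1 v1 v2 1 BO2) (hE2 : DBound₂ 0 1 v1 v2 0 BE2)
    (h1 : B ≤ BO1) (h2 : B ≤ BE1) (h3 : B ≤ BO2) (h4 : B ≤ BE2) (h6 : B ≤ -6) (hv : v1 ≤ v2) :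
    PWin.Holds ⟨0, 1, v1, v2, 0, B⟩ := by
  intro n p m _ hpr hm hsq hA hB hne
  simp only at hA hB hne ⊢
  have hp0 : 0 < p := hpr.pos
  have hsq' : 85 * n + 2 < p ^ 2 := by rw [pow_two]; exact hsq
  have hmp : m * p ≤ n := by simpa using hA
  have hn1 : 1 ≤ n := by nlinarith [hpr.two_le]
  by_cases hpn : p ∣ n
  · -- boundary prime: `n = m·p`
    obtain ⟨q, hq⟩ := hpn
    have hqm : q = m := by
      have hle : m ≤ q := by
        have : m * p ≤ q * p := by rw [Nat.mul_comm q p, ← hq]; exact hmp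
        exact Nat.le_of_mul_le_mul_right this hp0
      have hlt : v2 * (p * q) < (m * v2 + v1) * p := by rw [← hq]; exact hB
      by_contra hne'
      have hlt2 : m + 1 ≤ q := by omega
      have hv' : m * v2 + v1 ≤ v2 * q := by nlinarith
      have : (m * v2 + v1) * p ≤ v2 * (p * q) := by
        calc (m * v2 + v1) * p ≤ (v2 * q) * p := Nat.mul_le_mul_right p hv'
          _ = v2 * (p * q) := by ring
      omega
    subst hqm
    have hp5 : 5 ≤ p := by nlinarith
    have hdiv : (n / p : ℕ) = q := by rw [hq, Nat.mul_div_cancel_left q hp0]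
    have h := r0_bound_dvd hpr hp5 ⟨q, hq⟩ hn1 hsq hne
    rw [hdiv] at h
    linarith
  · -- interior prime: strict left end, then the rows by parity class
    have hA' : (m * 1 + 0) * p < 1 * n := by
      rcases hA.lt_or_eq with h | h
      · exact h
      · exfalso; exact hpn ⟨m, by linarith⟩
    rw [← bC1_bridge] at hne ⊢
    obtain ⟨t, ht⟩ : ∃ t, m = 1 + 2 * t ∨ m = 2 + 2 * t := ⟨(m - 1) / 2, by omega⟩
    rcases Nat.mod_two_eq_zero_or_one n with hn2 | hn2 <;> rcases ht with rfl | rfl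
    · have hA2 : (1 * 1 + 0) * p + 2 * 1 * (t * p) < 1 * n := by
        have e : (1 * 1 + 0) * p + 2 * 1 * (t * p) = ((1 + 2 * t) * 1 + 0) * p := by ring
        rw [e]; exact hA'
      have hB2 : v2 * n < (v2 * 1 + v1) * p + 2 * v2 * (t * p) := by
        have e : (v2 * 1 + v1) * p + 2 * v2 * (t * p) = ((1 + 2 * t) * v2 + v1) * p := by ring
        rw [e]; exact hB
      have := hE1 hpr hn2 hsq' hA2 hB2 hne
      push_cast; linarith
    · have hA2 : (1 * 2 + 0) * p + 2 * 1 * (t * p) < 1 * n := by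
        have e : (1 * 2 + 0) * p + 2 * 1 * (t * p) = ((2 + 2 * t) * 1 + 0) * p := by ring
        rw [e]; exact hA'
      have hB2 : v2 * n < (v2 * 2 + v1) * p + 2 * v2 * (t * p) := by
        have e : (v2 * 2 + v1) * p + 2 * v2 * (t * p) = ((2 + 2 * t) * v2 + v1) * p := by ring
        rw [e]; exact hB
      have := hE2 hpr hn2 hsq' hA2 hB2 hne
      push_cast; linarith
    · have hA2 : (1 * 1 + 0) * p + 2 * 1 * (t * p) < 1 * n := by
        have e : (1 * 1 + 0) * p + 2 * 1 * (t * p) = ((1 + 2 * t) * 1 + 0) * p := by ring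
        rw [e]; exact hA'
      have hB2 : v2 * n < (v2 * 1 + v1) * p + 2 * v2 * (t * p) := by
        have e : (v2 * 1 + v1) * p + 2 * v2 * (t * p) = ((1 + 2 * t) * v2 + v1) * p := by ring
        rw [e]; exact hB
      have := hO1 hpr hn2 hsq' hA2 hB2 hne
      push_cast; linarith
    · have hA2 : (1 * 2 + 0) * p + 2 * 1 * (t * p) < 1 * n := by
        have e : (1 * 2 + 0) * p + 2 * 1 * (t * p) = ((2 + 2 * t) * 1 + 0) * p := by ring
        rw [e]; exact hA'
      have hB2 : v2 * n < (v2 * 2 + v1) * p + 2 * v2 * (t * p) := by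
        have e : (v2 * 2 + v1) * p + 2 * v2 * (t * p) = ((2 + 2 * t) * v2 + v1) * p := by ring
        rw [e]; exact hB
      have := hO2 hpr hn2 hsq' hA2 hB2 hne
      push_cast; linarith

/-- **Cell `0`: `[0, 1/85)` together with its boundary `y = 0`, `B₁ = -6` for every shift `m ≥ 1`.** -/
theorem pwin_C0 : PWin.Holds ⟨0, 1, 1, 85, 0, -6⟩ :=
  pwin_holds_of_rows_zero C000O1.bound C000E1.bound C000O2.bound C000E2.bound
    (by norm_num) (by norm_num) (by norm_num) (by norm_num) le_rfl (by norm_num)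

/-- The PWin record of this part (cell 0 only), in the shape of the `RayC1KernelPeriodicPW<k>` modules. -/
def pwListZ : List PWin := [⟨0, 1, 1, 85, 0, -6⟩]

/-- Every record of this part holds. -/
theorem pwListZ_holds : ∀ c ∈ pwListZ, c.Holds := by
  intro c hc; simp only [pwListZ, List.mem_cons, List.not_mem_nil, or_false] at hc
  subst hc
  exact pwin_C0

end Summit.KontsevichZagierPeriods.Zeta5Search.RayC1
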